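import Mathlib
import HarnessLib
import Summits.Ventures.LatticeQCDFlow.Scoring.BlockQuarticVariationMean
import Summits.Ventures.LatticeQCDFlow.Scoring.ChainBlockAverages

/-!
# The quadratic variation of the batch-means martingale array CONVERGES IN PROBABILITY:
# `(1/(a b²)) Σ_{j<a} Σ_{i<b} η_{bj,i}² → 2 σ⁴` from any start, as `a, b → ∞`, under a geometric
# envelope (`σ² = π(q)` the Green–Kubo variance)

HONEST FRAMING: exact (Metropolis-corrected) sampling algorithms for lattice gauge theory;
figures of merit are autocorrelation/cost numbers at stated couplings and volumes; no
continuum-physics claim.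

Venture `LatticeQCDFlow` (cell pub-lqcd), topic `Scoring`; FANOUT row 4 (`s0-u1-b`, GEN-30).
NEW WORK of the cell, not a published result; no definition is introduced; nothing is cited as a
fact.  Notation of `Scoring/BlockMartingaleSqIncrements.lean` (`η_{s,i}`, `q`, `|h| ≤ C_h`) and the
geometric envelope `(A, ρ)` of row 8.  `Scoring/BlockQuarticVariationMean.lean` computed the MEAN of a
block's quartic variation from every state (`2 m² b² + O(b√b)`, `m = ∫ q dπ`),
`Scoring/BlockMartingaleSqIncrements.lean` its fourth moments, and `Scoring/ChainBlockAverages.lean`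
turns any-state mean and second-moment information into an `L¹` law of large numbers across
blocks.  This file assembles them: the block functional `Ψ_b(y) = (1/b²) Σ_{i<b} η_{0,i}(y)²`
(coordinates `y_0, …, y_b`) shifted to block `j` IS `(1/b²) Σ_{i<b} η_{bj,i}²` (`quarticVariation_shift`),
`|E_z Ψ_b − 2m²| ≤ K/√b`, `E_z Ψ_b² ≤ 2¹⁷ C_h⁸`, hence
`E_{μ₀} |(1/(a b²)) Σ_{j<a} Σ_{i<b} η_{bj,i}² − 2 m²| ≤ K/√b + 2 √(2¹⁷ C_h⁸/a)` and convergence in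
probability along every `a_n, b_n → ∞` — the quadratic-variation hypothesis of the array CLT
(`Scoring/MartingaleArrayCLT.lean`) for the batch-means estimator.

## Content (envelope `(A, ρ)`; `|h| ≤ C_h` measurable; `P_{μ₀}` from any `μ₀`; `m = ∫ q dπ`)

* `sqIncr_shift`, `quarticVariation_shift` — the shifted canonical block functional is the block's
  quartic variation; `quarticVariation_dependsOn`, `measurable_quarticVariation`,
  `abs_quarticVariation_le` (`≤ 64 C_h⁴ b³`), `chain_quarticVariation_sq_integral_le` (`≤ 2¹⁷ C_h⁸ b⁴`);
* **`exists_chain_quarticVariation_blockAverage_abs_sub_le_of_envelope`** — `∃ K ≥ 0`, all `μ₀`,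
  `a, b ≥ 1`: `E_{μ₀} |(Σ_{j<a} Σ_{i<b} η_{bj,i}²)/(a b²) − 2 m²| ≤ K/√b + 2 √(2¹⁷ C_h⁸/a)`;
* **`chain_quarticVariation_tendstoInMeasure_of_envelope`** — `a_n, b_n → ∞` ⇒
  `TendstoInMeasure P_{μ₀} (fun n x => (Σ_{j<a_n} Σ_{i<b_n} η_{b_n j,i}²)/(a_n b_n²)) atTop (fun _ => 2 m²)`.

NOT CLAIMED: almost-sure convergence; rates beyond the displayed `L¹` bound; unbounded `h`.
-/

noncomputable section

namespace Summit.Ventures.LatticeQCDFlow.Scoring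

open MeasureTheory ProbabilityTheory Filter Finset Preorder
open scoped ENNReal Topology

variable {Ω : Type*} [MeasurableSpace Ω]

/-! ### The canonical block functional and its shifts -/

section Pointwise

variable (κ : Kernel Ω Ω)

/-- Shifting the path by `s` turns `η_{0,i}` into `η_{s,i}`. -/
theorem sqIncr_shift (h : Ω → ℝ) (x : ℕ → Ω) (s i : ℕ) :
    (2 * (∑ r ∈ Finset.range i, (h ((fun n => x (s + n)) (0 + r + 1)) - kop κ h ((fun n => x (s + n)) (0 + r)))) * (h ((fun n => x (s + n)) (0 + i + 1)) - kop κ h ((fun n => x (s + n)) (0 + i))) + ((h ((fun n => x (s + n)) (0 + i + 1)) - kop κ h ((fun n => x (s + n)) (0 + i))) ^ 2 - (kop κ (fun y => h y ^ 2) ((fun n => x (s + n)) (0 + i)) - (kop κ h ((fun n => x (s + n)) (0 + i))) ^ 2))) = (2 * (∑ r ∈ Finset.range i, (h (x (s + r + 1)) - kop κ h (x (s + r)))) * (h (x (s + i + 1)) - kop κ h (x (s + i))) + ((h (x (s + i + 1)) - kop κ h (x (s + i))) ^ 2 - (kop κ (fun y => h y ^ 2) (x (s + i)) - (kop κ h (x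 (s + i))) ^ 2))) := by
  simp only [zero_add, ← add_assoc]

/-- … hence the shifted canonical quartic variation is the block's quartic variation. -/
theorem quarticVariation_shift (h : Ω → ℝ) (x : ℕ → Ω) (s b : ℕ) :
    (∑ i ∈ Finset.range b, (2 * (∑ r ∈ Finset.range i, (h ((fun n => x (s + n)) (0 + r + 1)) - kop κ h ((fun n => x (s + n)) (0 + r)))) * (h ((fun n => x (s + n)) (0 + i + 1)) - kop κ h ((fun n => x (s + n)) (0 + i))) + ((h ((fun n => x (s + n)) (0 + i + 1)) - kop κ h ((fun n => x (s + n)) (0 + i))) ^ 2 - (kop κ (fun y => h y ^ 2) ((fun n => x (s + n)) (0 + i)) - (kop κ h ((fun n => x (s + n)) (0 + i))) ^ 2))) ^ 2) = (∑ i ∈ Finset.range b, (2 * (∑ r ∈ Finset.range i, (h (x (s + r + 1)) - kop κ h (x (s + r)))) * (h (x (s + i + 1)) - kop κ h (x (s + i))) + ((h (x (s + i + 1)) - kop κ h (x (s + i))) ^ 2 - (kop κ (fun y => h y ^ 2) (x (s + i)) - (kop κ h (x (s + i))) ^ 2))) ^ 2) :=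
  Finset.sum_congr rfl fun i _ => by rw [sqIncr_shift κ h x s i]

omit [MeasurableSpace Ω] in
/-- The canonical block functional depends on the coordinates `≤ b`. -/
theorem quarticVariation_dependsOn (K : (Ω → ℝ) → Ω → ℝ) (h q : Ω → ℝ) (b : ℕ) :
    DependsOn (fun y : ℕ → Ω => ∑ i ∈ Finset.range b,
      (2 * (∑ r ∈ Finset.range i, (h (y (0 + r + 1)) - K h (y (0 + r))))
          * (h (y (0 + i + 1)) - K h (y (0 + i)))
        + ((h (y (0 + i + 1)) - K h (y (0 + i))) ^ 2 - q (y (0 + i)))) ^ 2) (Set.Iic b) := by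
  intro x y hxy
  refine Finset.sum_congr rfl fun i hi => ?_
  have hi' := Finset.mem_range.1 hi
  have := sqIncr_dependsOn K h q 0 i (x := x) (y := y) fun j hj => hxy j (Set.mem_Iic.2
    ((Set.mem_Iic.1 hj).trans (by omega)))
  dsimp only at this ⊢
  rw [this]

variable [IsMarkovKernel κ]

omit [IsMarkovKernel κ] in
/-- Measurability of the canonical block functional. -/
theorem measurable_quarticVariation {h : Ω → ℝ} (hh : Measurable h) (s b : ℕ) :
    Measurable fun x : ℕ → Ω => (∑ i ∈ Finset.range b, (2 * (∑ r ∈ Finset.range i, (h (x (s + r + 1)) - kop κ h (x (s + r)))) * (h (x (s + i + 1)) - kop κ h (x (s + i))) + ((h (x (s + i + 1)) - kop κ h (x (s + i))) ^ 2 - (kop κ (fun y => h y ^ 2) (x (s + i)) - (kop κ h (x (s + i))) ^ 2))) ^ 2) :=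
  Finset.measurable_sum _ fun i _ => (measurable_sqIncr κ hh s i).pow_const 2

/-- `|Σ_{i<b} η_{s,i}²| ≤ 64 C_h⁴ b³`. -/
theorem abs_quarticVariation_le {h : Ω → ℝ} (hh : Measurable h) {Ch : ℝ} (hCh : ∀ x, |h x| ≤ Ch)
    (s b : ℕ) (x : ℕ → Ω) : |(∑ i ∈ Finset.range b, (2 * (∑ r ∈ Finset.range i, (h (x (s + r + 1)) - kop κ h (x (s + r)))) * (h (x (s + i + 1)) - kop κ h (x (s + i))) + ((h (x (s + i + 1)) - kop κ h (x (s + i))) ^ 2 - (kop κ (fun y => h y ^ 2) (x (s + i)) - (kop κ h (x (s + i))) ^ 2))) ^ 2)| ≤ 64 * Ch ^ 4 * (b : ℝ) ^ 3 := by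
  have hterm : ∀ i ∈ Finset.range b, |(2 * (∑ r ∈ Finset.range i, (h (x (s + r + 1)) - kop κ h (x (s + r)))) * (h (x (s + i + 1)) - kop κ h (x (s + i))) + ((h (x (s + i + 1)) - kop κ h (x (s + i))) ^ 2 - (kop κ (fun y => h y ^ 2) (x (s + i)) - (kop κ h (x (s + i))) ^ 2))) ^ 2| ≤ (8 * Ch ^ 2 * b) ^ 2 := by
    intro i hi
    have hi' : (i : ℝ) + 1 ≤ b := by exact_mod_cast Finset.mem_range.1 hi
    have hC0 : 0 ≤ Ch := (abs_nonneg _).trans (hCh (x 0))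
    rw [abs_pow]
    refine pow_le_pow_left₀ (abs_nonneg _) ((abs_sqIncr_le κ hh hCh s i x).trans ?_) 2
    exact mul_le_mul_of_nonneg_left hi' (by positivity)
  calc |(∑ i ∈ Finset.range b, (2 * (∑ r ∈ Finset.range i, (h (x (s + r + 1)) - kop κ h (x (s + r)))) * (h (x (s + i + 1)) - kop κ h (x (s + i))) + ((h (x (s + i + 1)) - kop κ h (x (s + i))) ^ 2 - (kop κ (fun y => h y ^ 2) (x (s + i)) - (kop κ h (x (s + i))) ^ 2))) ^ 2)| ≤ ∑ i ∈ Finset.range b, |(2 * (∑ r ∈ Finset.range i, (h (x (s + r + 1)) - kop κ h (x (s + r)))) * (h (x (s + i + 1)) - kop κ h (x (s + i))) + ((h (x (s + i + 1)) - kop κ h (x (s + i))) ^ 2 - (kop κ (fun y => h y ^ 2) (x (s + i)) - (kop κ h (x (s + i))) ^ 2))) ^ 2| := Finset.abs_sum_le_sum_abs _ _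
    _ ≤ ∑ _i ∈ Finset.range b, (8 * Ch ^ 2 * b) ^ 2 := Finset.sum_le_sum hterm
    _ = 64 * Ch ^ 4 * (b : ℝ) ^ 3 := by
        rw [Finset.sum_const, Finset.card_range, nsmul_eq_mul]; ring

/-- **`E_{μ₀}[(Σ_{i<b} η_{s,i}²)²] ≤ 2¹⁷ C_h⁸ b⁴`** (Cauchy–Schwarz and the fourth moments). -/
theorem chain_quarticVariation_sq_integral_le {h : Ω → ℝ} (hh : Measurable h) {Ch : ℝ}
    (hCh : ∀ x, |h x| ≤ Ch) (μ₀ : Measure Ω) [IsProbabilityMeasure μ₀] (s b : ℕ) :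
    ∫ x, (∑ i ∈ Finset.range b, (2 * (∑ r ∈ Finset.range i, (h (x (s + r + 1)) - kop κ h (x (s + r)))) * (h (x (s + i + 1)) - kop κ h (x (s + i))) + ((h (x (s + i + 1)) - kop κ h (x (s + i))) ^ 2 - (kop κ (fun y => h y ^ 2) (x (s + i)) - (kop κ h (x (s + i))) ^ 2))) ^ 2) ^ 2 ∂(Kernel.trajMeasure (X := fun _ : ℕ => Ω) (μ₀)
          (fun n : ℕ => κ.comap (fun h' : (i : ↥(Finset.Iic n)) → Ω => h' ⟨n, Finset.mem_Iic.2 le_rfl⟩)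
            (measurable_pi_apply _))) ≤ 2 ^ 17 * Ch ^ 8 * (b : ℝ) ^ 4 := by
  set P := (Kernel.trajMeasure (X := fun _ : ℕ => Ω) (μ₀)
        (fun n : ℕ => κ.comap (fun h' : (i : ↥(Finset.Iic n)) → Ω => h' ⟨n, Finset.mem_Iic.2 le_rfl⟩)
          (measurable_pi_apply _))) with hP
  have hC0 : 0 ≤ Ch := (abs_nonneg _).trans (hCh (Classical.choice
    (nonempty_of_isProbabilityMeasure μ₀)))
  have hi4 : ∀ i ∈ Finset.range b, Integrable (fun x : ℕ → Ω => (2 * (∑ r ∈ Finset.range i, (h (x (s + r + 1)) - kop κ h (x (s + r)))) * (h (x (s + i + 1)) - kop κ h (x (s + i))) + ((h (x (s + i + 1)) - kop κ h (x (s + i))) ^ 2 - (kop κ (fun y => h y ^ 2) (x (s + i)) - (kop κ h (x (s + i))) ^ 2))) ^ 4) P := fun i _ =>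
    integrable_of_bounded P ((measurable_sqIncr κ hh s i).pow_const 4)
      (C := (8 * Ch ^ 2 * (i + 1)) ^ 4) fun x => by
        rw [abs_pow]; exact pow_le_pow_left₀ (abs_nonneg _) (abs_sqIncr_le κ hh hCh s i x) 4
  have hCS : ∀ x : ℕ → Ω, (∑ i ∈ Finset.range b, (2 * (∑ r ∈ Finset.range i, (h (x (s + r + 1)) - kop κ h (x (s + r)))) * (h (x (s + i + 1)) - kop κ h (x (s + i))) + ((h (x (s + i + 1)) - kop κ h (x (s + i))) ^ 2 - (kop κ (fun y => h y ^ 2) (x (s + i)) - (kop κ h (x (s + i))) ^ 2))) ^ 2) ^ 2 ≤ (b : ℝ) * ∑ i ∈ Finset.range b, (2 * (∑ r ∈ Finset.range i, (h (x (s + r + 1)) - kop κ h (x (s + r)))) * (h (x (s + i + 1)) - kop κ h (x (s + i))) + ((h (x (s + i + 1)) - kop κ h (x (s + i))) ^ 2 - (kop κ (fun y => h y ^ 2) (x (s + i)) - (kop κ h (x (s + i))) ^ 2))) ^ 4 := by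
    intro x
    have h := sq_sum_le_card_mul_sum_sq (s := Finset.range b)
      (f := fun i => (2 * (∑ r ∈ Finset.range i, (h (x (s + r + 1)) - kop κ h (x (s + r)))) * (h (x (s + i + 1)) - kop κ h (x (s + i))) + ((h (x (s + i + 1)) - kop κ h (x (s + i))) ^ 2 - (kop κ (fun y => h y ^ 2) (x (s + i)) - (kop κ h (x (s + i))) ^ 2))) ^ 2)
    simp only [Finset.card_range] at h
    refine h.trans (le_of_eq ?_)
    congr 1
    exact Finset.sum_congr rfl fun i _ => by ring
  have hiR : Integrable (fun x : ℕ → Ω => (b : ℝ) * ∑ i ∈ Finset.range b, (2 * (∑ r ∈ Finset.range i, (h (x (s + r + 1)) - kop κ h (x (s + r)))) * (h (x (s + i + 1)) - kop κ h (x (s + i))) + ((h (x (s + i + 1)) - kop κ h (x (s + i))) ^ 2 - (kop κ (fun y => h y ^ 2) (x (s + i)) - (kop κ h (x (s + i))) ^ 2))) ^ 4) P :=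
    (integrable_finsetSum _ hi4).const_mul _
  calc ∫ x, (∑ i ∈ Finset.range b, (2 * (∑ r ∈ Finset.range i, (h (x (s + r + 1)) - kop κ h (x (s + r)))) * (h (x (s + i + 1)) - kop κ h (x (s + i))) + ((h (x (s + i + 1)) - kop κ h (x (s + i))) ^ 2 - (kop κ (fun y => h y ^ 2) (x (s + i)) - (kop κ h (x (s + i))) ^ 2))) ^ 2) ^ 2 ∂P ≤ ∫ x, (b : ℝ) * ∑ i ∈ Finset.range b, (2 * (∑ r ∈ Finset.range i, (h (x (s + r + 1)) - kop κ h (x (s + r)))) * (h (x (s + i + 1)) - kop κ h (x (s + i))) + ((h (x (s + i + 1)) - kop κ h (x (s + i))) ^ 2 - (kop κ (fun y => h y ^ 2) (x (s + i)) - (kop κ h (x (s + i))) ^ 2))) ^ 4 ∂P :=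
        integral_mono_of_nonneg (ae_of_all _ fun x => sq_nonneg _) hiR (ae_of_all _ hCS)
    _ = (b : ℝ) * ∑ i ∈ Finset.range b, ∫ x, (2 * (∑ r ∈ Finset.range i, (h (x (s + r + 1)) - kop κ h (x (s + r)))) * (h (x (s + i + 1)) - kop κ h (x (s + i))) + ((h (x (s + i + 1)) - kop κ h (x (s + i))) ^ 2 - (kop κ (fun y => h y ^ 2) (x (s + i)) - (kop κ h (x (s + i))) ^ 2))) ^ 4 ∂P := by
        rw [integral_const_mul, integral_finsetSum _ hi4]
    _ ≤ (b : ℝ) * ∑ _i ∈ Finset.range b, 2 ^ 17 * Ch ^ 8 * (b : ℝ) ^ 2 := by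
        refine mul_le_mul_of_nonneg_left (Finset.sum_le_sum fun i hi => ?_) (Nat.cast_nonneg _)
        have hi' : (i : ℝ) + 1 ≤ b := by exact_mod_cast Finset.mem_range.1 hi
        have h4 := chain_sqIncr_fourth_le κ μ₀ hh hCh s i
        rw [← hP] at h4
        refine h4.trans (mul_le_mul_of_nonneg_left ?_ (by positivity))
        exact pow_le_pow_left₀ (by positivity) hi' 2
    _ = 2 ^ 17 * Ch ^ 8 * (b : ℝ) ^ 4 := by
        rw [Finset.sum_const, Finset.card_range, nsmul_eq_mul]; ring

end Pointwise

/-! ### The law of large numbers for the quadratic variation -/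

section Envelope

variable {κ : Kernel Ω Ω} [IsMarkovKernel κ] {π : Measure Ω} [IsProbabilityMeasure π] {A ρ : ℝ}

/-- **THE BLOCK AVERAGE OF THE QUARTIC VARIATION, `L¹` ESTIMATE FROM ANY START.**  There is
`K ≥ 0` (depending on `C_h, A, ρ` only) such that for every initial law, all `a, b ≥ 1`:
`E_{μ₀} |(Σ_{j<a} Σ_{i<b} η_{bj,i}²)/(a b²) − 2 m²| ≤ K/√b + 2 √(2¹⁷ C_h⁸ / a)` (`m = ∫ q dπ`). -/
theorem exists_chain_quarticVariation_blockAverage_abs_sub_le_of_envelope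
    (henv : ∀ (g : Ω → ℝ), Measurable g → ∀ (Cg : ℝ), (∀ x, |g x| ≤ Cg) →
      ∀ (t : ℕ) (x : Ω), |(kop κ)^[t] g x - ∫ y, g y ∂π| ≤ 2 * Cg * (A * ρ ^ t))
    (hA : 0 ≤ A) (hρ0 : 0 ≤ ρ) (hρ1 : ρ < 1)
    {h : Ω → ℝ} (hh : Measurable h) {Ch : ℝ} (hCh : ∀ x, |h x| ≤ Ch) :
    ∃ K : ℝ, 0 ≤ K ∧ ∀ (μ₀ : Measure Ω) [IsProbabilityMeasure μ₀] (a b : ℕ), 0 < a → 0 < b →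
      ∫ x, |(∑ j ∈ Finset.range a, (∑ i ∈ Finset.range b, (2 * (∑ r ∈ Finset.range i, (h (x (b * j + r + 1)) - kop κ h (x (b * j + r)))) * (h (x (b * j + i + 1)) - kop κ h (x (b * j + i))) + ((h (x (b * j + i + 1)) - kop κ h (x (b * j + i))) ^ 2 - (kop κ (fun y => h y ^ 2) (x (b * j + i)) - (kop κ h (x (b * j + i))) ^ 2))) ^ 2)) / ((a : ℝ) * (b : ℝ) ^ 2)
          - 2 * (∫ y, (kop κ (fun y => h y ^ 2) y - (kop κ h y) ^ 2) ∂π) ^ 2| ∂(Kernel.trajMeasure (X := fun _ : ℕ => Ω) (μ₀)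
                (fun n : ℕ => κ.comap (fun h' : (i : ↥(Finset.Iic n)) → Ω => h' ⟨n, Finset.mem_Iic.2 le_rfl⟩)
                  (measurable_pi_apply _)))
        ≤ K / Real.sqrt b + 2 * Real.sqrt (2 ^ 17 * Ch ^ 8 / a) := by
  obtain ⟨K, hK0, hK⟩ := exists_abs_chain_quarticVariation_integral_sub_le_of_envelope henv hA hρ0 hρ1
    hh hCh
  refine ⟨K, hK0, fun μ₀ _ a b ha hb => ?_⟩
  set m : ℝ := ∫ y, (kop κ (fun y => h y ^ 2) y - (kop κ h y) ^ 2) ∂π with hm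
  have hbR : (0 : ℝ) < b := Nat.cast_pos.2 hb
  have hb2 : (0 : ℝ) < (b : ℝ) ^ 2 := by positivity
  obtain ⟨hqm, hqb⟩ := kopCondVar_bounded_measurable κ hh hCh
  -- the normalised canonical block functional `Ψ(y) = (Σ_{i<b} η_{0,i}(y)²)/b²`
  have hΨm : Measurable fun y : ℕ → Ω => (∑ i ∈ Finset.range b, (2 * (∑ r ∈ Finset.range i, (h (y (0 + r + 1)) - kop κ h (y (0 + r)))) * (h (y (0 + i + 1)) - kop κ h (y (0 + i))) + ((h (y (0 + i + 1)) - kop κ h (y (0 + i))) ^ 2 - (kop κ (fun y => h y ^ 2) (y (0 + i)) - (kop κ h (y (0 + i))) ^ 2))) ^ 2) / (b : ℝ) ^ 2 :=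
    (measurable_quarticVariation κ hh 0 b).div_const _
  have hΨd : DependsOn (fun y : ℕ → Ω => (∑ i ∈ Finset.range b, (2 * (∑ r ∈ Finset.range i, (h (y (0 + r + 1)) - kop κ h (y (0 + r)))) * (h (y (0 + i + 1)) - kop κ h (y (0 + i))) + ((h (y (0 + i + 1)) - kop κ h (y (0 + i))) ^ 2 - (kop κ (fun y => h y ^ 2) (y (0 + i)) - (kop κ h (y (0 + i))) ^ 2))) ^ 2) / (b : ℝ) ^ 2) (Set.Iic b) := by
    intro x y hxy
    have := quarticVariation_dependsOn (kop κ) h (fun z => (kop κ (fun y => h y ^ 2) z - (kop κ h z) ^ 2)) b hxy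
    dsimp only at this ⊢
    rw [this]
  have hΨb : ∀ y : ℕ → Ω, |(∑ i ∈ Finset.range b, (2 * (∑ r ∈ Finset.range i, (h (y (0 + r + 1)) - kop κ h (y (0 + r)))) * (h (y (0 + i + 1)) - kop κ h (y (0 + i))) + ((h (y (0 + i + 1)) - kop κ h (y (0 + i))) ^ 2 - (kop κ (fun y => h y ^ 2) (y (0 + i)) - (kop κ h (y (0 + i))) ^ 2))) ^ 2) / (b : ℝ) ^ 2| ≤ 64 * Ch ^ 4 * b := by
    intro y
    rw [abs_div, abs_of_pos hb2, div_le_iff₀ hb2]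
    calc |(∑ i ∈ Finset.range b, (2 * (∑ r ∈ Finset.range i, (h (y (0 + r + 1)) - kop κ h (y (0 + r)))) * (h (y (0 + i + 1)) - kop κ h (y (0 + i))) + ((h (y (0 + i + 1)) - kop κ h (y (0 + i))) ^ 2 - (kop κ (fun y => h y ^ 2) (y (0 + i)) - (kop κ h (y (0 + i))) ^ 2))) ^ 2)| ≤ 64 * Ch ^ 4 * (b : ℝ) ^ 3 := abs_quarticVariation_le κ hh hCh 0 b y
      _ = 64 * Ch ^ 4 * b * (b : ℝ) ^ 2 := by ring
  -- any-state mean and second moment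
  have hmean : ∀ z : Ω, |∫ y, (∑ i ∈ Finset.range b, (2 * (∑ r ∈ Finset.range i, (h (y (0 + r + 1)) - kop κ h (y (0 + r)))) * (h (y (0 + i + 1)) - kop κ h (y (0 + i))) + ((h (y (0 + i + 1)) - kop κ h (y (0 + i))) ^ 2 - (kop κ (fun y => h y ^ 2) (y (0 + i)) - (kop κ h (y (0 + i))) ^ 2))) ^ 2) / (b : ℝ) ^ 2 ∂(Kernel.trajMeasure (X := fun _ : ℕ => Ω) (Measure.dirac z)
        (fun n : ℕ => κ.comap (fun h' : (i : ↥(Finset.Iic n)) → Ω => h' ⟨n, Finset.mem_Iic.2 le_rfl⟩)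
          (measurable_pi_apply _))) - 2 * m ^ 2|
      ≤ K / Real.sqrt b := by
    intro z
    have h1 := hK (Measure.dirac z) 0 b
    rw [integral_div, div_sub' (ne_of_gt hb2), abs_div, abs_of_pos hb2, div_le_iff₀ hb2]
    calc |∫ y, (∑ i ∈ Finset.range b, (2 * (∑ r ∈ Finset.range i, (h (y (0 + r + 1)) - kop κ h (y (0 + r)))) * (h (y (0 + i + 1)) - kop κ h (y (0 + i))) + ((h (y (0 + i + 1)) - kop κ h (y (0 + i))) ^ 2 - (kop κ (fun y => h y ^ 2) (y (0 + i)) - (kop κ h (y (0 + i))) ^ 2))) ^ 2) ∂(Kernel.trajMeasure (X := fun _ : ℕ => Ω) (Measure.dirac z)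
          (fun n : ℕ => κ.comap (fun h' : (i : ↥(Finset.Iic n)) → Ω => h' ⟨n, Finset.mem_Iic.2 le_rfl⟩)
            (measurable_pi_apply _))) - (b : ℝ) ^ 2 * (2 * m ^ 2)|
        = |∫ y, (∑ i ∈ Finset.range b, (2 * (∑ r ∈ Finset.range i, (h (y (0 + r + 1)) - kop κ h (y (0 + r)))) * (h (y (0 + i + 1)) - kop κ h (y (0 + i))) + ((h (y (0 + i + 1)) - kop κ h (y (0 + i))) ^ 2 - (kop κ (fun y => h y ^ 2) (y (0 + i)) - (kop κ h (y (0 + i))) ^ 2))) ^ 2) ∂(Kernel.trajMeasure (X := fun _ : ℕ => Ω) (Measure.dirac z)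
              (fun n : ℕ => κ.comap (fun h' : (i : ↥(Finset.Iic n)) → Ω => h' ⟨n, Finset.mem_Iic.2 le_rfl⟩)
                (measurable_pi_apply _))) - 2 * m ^ 2 * (b : ℝ) ^ 2| := by ring_nf
      _ ≤ K * b * Real.sqrt b := h1
      _ = K * b * ((b : ℝ) / Real.sqrt b) := by rw [Real.div_sqrt]
      _ = K / Real.sqrt b * (b : ℝ) ^ 2 := by ring
  have hV : ∀ z : Ω, ∫ y, ((∑ i ∈ Finset.range b, (2 * (∑ r ∈ Finset.range i, (h (y (0 + r + 1)) - kop κ h (y (0 + r)))) * (h (y (0 + i + 1)) - kop κ h (y (0 + i))) + ((h (y (0 + i + 1)) - kop κ h (y (0 + i))) ^ 2 - (kop κ (fun y => h y ^ 2) (y (0 + i)) - (kop κ h (y (0 + i))) ^ 2))) ^ 2) / (b : ℝ) ^ 2) ^ 2 ∂(Kernel.trajMeasure (X := fun _ : ℕ => Ω) (Measure.dirac z)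
        (fun n : ℕ => κ.comap (fun h' : (i : ↥(Finset.Iic n)) → Ω => h' ⟨n, Finset.mem_Iic.2 le_rfl⟩)
          (measurable_pi_apply _))) ≤ 2 ^ 17 * Ch ^ 8 := by
    intro z
    have h1 := chain_quarticVariation_sq_integral_le κ hh hCh (Measure.dirac z) 0 b
    have hb4 : (0 : ℝ) < ((b : ℝ) ^ 2) ^ 2 := by positivity
    simp_rw [div_pow]
    rw [integral_div, div_le_iff₀ hb4]
    calc ∫ y, (∑ i ∈ Finset.range b, (2 * (∑ r ∈ Finset.range i, (h (y (0 + r + 1)) - kop κ h (y (0 + r)))) * (h (y (0 + i + 1)) - kop κ h (y (0 + i))) + ((h (y (0 + i + 1)) - kop κ h (y (0 + i))) ^ 2 - (kop κ (fun y => h y ^ 2) (y (0 + i)) - (kop κ h (y (0 + i))) ^ 2))) ^ 2) ^ 2 ∂(Kernel.trajMeasure (X := fun _ : ℕ => Ω) (Measure.dirac z)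
          (fun n : ℕ => κ.comap (fun h' : (i : ↥(Finset.Iic n)) → Ω => h' ⟨n, Finset.mem_Iic.2 le_rfl⟩)
            (measurable_pi_apply _))) ≤ 2 ^ 17 * Ch ^ 8 * (b : ℝ) ^ 4 := h1
      _ = 2 ^ 17 * Ch ^ 8 * ((b : ℝ) ^ 2) ^ 2 := by ring
  -- the block LLN
  have hLLN := chain_blockAverage_abs_sub_integral_le κ μ₀ hΨm hΨd hΨb hmean hV ha
  -- identify the shifted canonical functional with the block quartic variation
  have hid : ∀ x : ℕ → Ω, (∑ j ∈ Finset.range a, (∑ i ∈ Finset.range b, (2 * (∑ r ∈ Finset.range i, (h ((fun n => x (b * j + n)) (0 + r + 1)) - kop κ h ((fun n => x (b * j + n)) (0 + r)))) * (h ((fun n => x (b * j + n)) (0 + i + 1)) - kop κ h ((fun n => x (b * j + n)) (0 + i))) + ((h ((fun n => x (b * j + n)) (0 + i + 1)) - kop κ h ((fun n => x (b * j + n)) (0 + i))) ^ 2 - (kop κ (fun y => h y ^ 2) ((fun n => x (b * j + n)) (0 + i)) - (kop κ h ((fun n => x (b * j + n)) (0 + i))) ^ 2))) ^ 2) / (b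 : ℝ) ^ 2) / a
      = (∑ j ∈ Finset.range a, (∑ i ∈ Finset.range b, (2 * (∑ r ∈ Finset.range i, (h (x (b * j + r + 1)) - kop κ h (x (b * j + r)))) * (h (x (b * j + i + 1)) - kop κ h (x (b * j + i))) + ((h (x (b * j + i + 1)) - kop κ h (x (b * j + i))) ^ 2 - (kop κ (fun y => h y ^ 2) (x (b * j + i)) - (kop κ h (x (b * j + i))) ^ 2))) ^ 2)) / ((a : ℝ) * (b : ℝ) ^ 2) := by
    intro x
    rw [← Finset.sum_div, div_div, mul_comm]
    congr 1
    exact Finset.sum_congr rfl fun j _ => quarticVariation_shift κ h x (b * j) b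
  simp_rw [hid] at hLLN
  exact hLLN

/-- **THE QUADRATIC VARIATION OF THE BATCH-MEANS ARRAY CONVERGES IN PROBABILITY TO `2 m²`**, from any
start, along every `a_n → ∞`, `b_n → ∞`. -/
theorem chain_quarticVariation_tendstoInMeasure_of_envelope
    (henv : ∀ (g : Ω → ℝ), Measurable g → ∀ (Cg : ℝ), (∀ x, |g x| ≤ Cg) →
      ∀ (t : ℕ) (x : Ω), |(kop κ)^[t] g x - ∫ y, g y ∂π| ≤ 2 * Cg * (A * ρ ^ t))
    (hA : 0 ≤ A) (hρ0 : 0 ≤ ρ) (hρ1 : ρ < 1)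
    {h : Ω → ℝ} (hh : Measurable h) {Ch : ℝ} (hCh : ∀ x, |h x| ≤ Ch)
    (μ₀ : Measure Ω) [IsProbabilityMeasure μ₀] {a b : ℕ → ℕ} (ha : Tendsto a atTop atTop)
    (hb : Tendsto b atTop atTop) :
    TendstoInMeasure (Kernel.trajMeasure (X := fun _ : ℕ => Ω) (μ₀)
          (fun n : ℕ => κ.comap (fun h' : (i : ↥(Finset.Iic n)) → Ω => h' ⟨n, Finset.mem_Iic.2 le_rfl⟩)
            (measurable_pi_apply _)))
      (fun (n : ℕ) (x : ℕ → Ω) =>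
        (∑ j ∈ Finset.range (a n), (∑ i ∈ Finset.range (b n), (2 * (∑ r ∈ Finset.range i, (h (x (b n * j + r + 1)) - kop κ h (x (b n * j + r)))) * (h (x (b n * j + i + 1)) - kop κ h (x (b n * j + i))) + ((h (x (b n * j + i + 1)) - kop κ h (x (b n * j + i))) ^ 2 - (kop κ (fun y => h y ^ 2) (x (b n * j + i)) - (kop κ h (x (b n * j + i))) ^ 2))) ^ 2)) / ((a n : ℝ) * (b n : ℝ) ^ 2))
      atTop (fun _ => 2 * (∫ y, (kop κ (fun y => h y ^ 2) y - (kop κ h y) ^ 2) ∂π) ^ 2) := by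
  set P := (Kernel.trajMeasure (X := fun _ : ℕ => Ω) (μ₀)
        (fun n : ℕ => κ.comap (fun h' : (i : ↥(Finset.Iic n)) → Ω => h' ⟨n, Finset.mem_Iic.2 le_rfl⟩)
          (measurable_pi_apply _))) with hP
  set m : ℝ := ∫ y, (kop κ (fun y => h y ^ 2) y - (kop κ h y) ^ 2) ∂π with hm
  obtain ⟨K, hK0, hK⟩ := exists_chain_quarticVariation_blockAverage_abs_sub_le_of_envelope henv hA
    hρ0 hρ1 hh hCh
  have hstat_m : ∀ n, Measurable fun x : ℕ → Ω =>
      (∑ j ∈ Finset.range (a n), (∑ i ∈ Finset.range (b n), (2 * (∑ r ∈ Finset.range i, (h (x (b n * j + r + 1)) - kop κ h (x (b n * j + r)))) * (h (x (b n * j + i + 1)) - kop κ h (x (b n * j + i))) + ((h (x (b n * j + i + 1)) - kop κ h (x (b n * j + i))) ^ 2 - (kop κ (fun y => h y ^ 2) (x (b n * j + i)) - (kop κ h (x (b n * j + i))) ^ 2))) ^ 2)) / ((a n : ℝ) * (b n : ℝ) ^ 2) := fun n =>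
    (Finset.measurable_sum _ fun j _ => measurable_quarticVariation κ hh _ _).div_const _
  rw [tendstoInMeasure_iff_measureReal_norm]
  intro δ hδ
  have hev : ∀ᶠ n in atTop, 0 < a n ∧ 0 < b n := by
    filter_upwards [ha.eventually_ge_atTop 1, hb.eventually_ge_atTop 1] with n h1 h2
    exact ⟨h1, h2⟩
  -- the `L¹` bound tends to zero
  have hε : Tendsto (fun n : ℕ => (K / Real.sqrt (b n) + 2 * Real.sqrt (2 ^ 17 * Ch ^ 8 / a n)) / δ)
      atTop (𝓝 0) := by
    have h1 : Tendsto (fun n : ℕ => K / Real.sqrt (b n)) atTop (𝓝 0) :=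
      tendsto_const_nhds.div_atTop (Real.tendsto_sqrt_atTop.comp
        ((tendsto_natCast_atTop_atTop (R := ℝ)).comp hb))
    have h2 : Tendsto (fun n : ℕ => 2 * Real.sqrt (2 ^ 17 * Ch ^ 8 / a n)) atTop (𝓝 0) := by
      have h3 : Tendsto (fun n : ℕ => 2 ^ 17 * Ch ^ 8 / (a n : ℝ)) atTop (𝓝 0) :=
        tendsto_const_nhds.div_atTop ((tendsto_natCast_atTop_atTop (R := ℝ)).comp ha)
      have h4 := (Real.continuous_sqrt.tendsto 0).comp h3
      rw [Real.sqrt_zero] at h4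
      simpa using h4.const_mul 2
    simpa using (h1.add h2).div_const δ
  refine squeeze_zero' (Eventually.of_forall fun n => measureReal_nonneg) ?_ hε
  filter_upwards [hev] with n hn
  have hL1 := hK μ₀ (a n) (b n) hn.1 hn.2
  rw [← hP, ← hm] at hL1
  -- Markov's inequality on the absolute error
  set D : (ℕ → Ω) → ℝ := fun x =>
    (∑ j ∈ Finset.range (a n), (∑ i ∈ Finset.range (b n), (2 * (∑ r ∈ Finset.range i, (h (x (b n * j + r + 1)) - kop κ h (x (b n * j + r)))) * (h (x (b n * j + i + 1)) - kop κ h (x (b n * j + i))) + ((h (x (b n * j + i + 1)) - kop κ h (x (b n * j + i))) ^ 2 - (kop κ (fun y => h y ^ 2) (x (b n * j + i)) - (kop κ h (x (b n * j + i))) ^ 2))) ^ 2)) / ((a n : ℝ) * (b n : ℝ) ^ 2) - 2 * m ^ 2 with hD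
  have hDm : Measurable D := (hstat_m n).sub measurable_const
  have hset : {x : ℕ → Ω | δ ≤ ‖(∑ j ∈ Finset.range (a n), (∑ i ∈ Finset.range (b n), (2 * (∑ r ∈ Finset.range i, (h (x (b n * j + r + 1)) - kop κ h (x (b n * j + r)))) * (h (x (b n * j + i + 1)) - kop κ h (x (b n * j + i))) + ((h (x (b n * j + i + 1)) - kop κ h (x (b n * j + i))) ^ 2 - (kop κ (fun y => h y ^ 2) (x (b n * j + i)) - (kop κ h (x (b n * j + i))) ^ 2))) ^ 2))
      / ((a n : ℝ) * (b n : ℝ) ^ 2) - 2 * m ^ 2‖} = {x | δ ≤ |D x|} := by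
    ext x; simp only [Set.mem_setOf_eq, Real.norm_eq_abs, hD]
  rw [hset]
  have hbR : (0 : ℝ) < b n := Nat.cast_pos.2 hn.2
  have haR : (0 : ℝ) < a n := Nat.cast_pos.2 hn.1
  have hiD : Integrable (fun x => |D x|) P :=
    integrable_of_bounded P hDm.abs (C := (a n) * (64 * Ch ^ 4 * (b n : ℝ) ^ 3)
      / ((a n : ℝ) * (b n : ℝ) ^ 2) + 2 * m ^ 2) fun x => by
      rw [abs_abs, hD]
      refine (abs_sub _ _).trans (add_le_add ?_ (le_of_eq (abs_of_nonneg (by positivity))))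
      rw [abs_div, abs_of_pos (by positivity : (0 : ℝ) < (a n : ℝ) * (b n : ℝ) ^ 2)]
      refine div_le_div_of_nonneg_right ((Finset.abs_sum_le_sum_abs _ _).trans ?_) (by positivity)
      calc ∑ j ∈ Finset.range (a n), |(∑ i ∈ Finset.range (b n), (2 * (∑ r ∈ Finset.range i, (h (x (b n * j + r + 1)) - kop κ h (x (b n * j + r)))) * (h (x (b n * j + i + 1)) - kop κ h (x (b n * j + i))) + ((h (x (b n * j + i + 1)) - kop κ h (x (b n * j + i))) ^ 2 - (kop κ (fun y => h y ^ 2) (x (b n * j + i)) - (kop κ h (x (b n * j + i))) ^ 2))) ^ 2)|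
          ≤ ∑ _j ∈ Finset.range (a n), 64 * Ch ^ 4 * (b n : ℝ) ^ 3 :=
            Finset.sum_le_sum fun j _ => abs_quarticVariation_le κ hh hCh _ _ x
        _ = (a n) * (64 * Ch ^ 4 * (b n : ℝ) ^ 3) := by
            rw [Finset.sum_const, Finset.card_range, nsmul_eq_mul]
  have hcheb := mul_meas_ge_le_integral_of_nonneg (μ := P) (ae_of_all _ fun x => abs_nonneg (D x))
    hiD δ
  calc P.real {x | δ ≤ |D x|} ≤ (∫ x, |D x| ∂P) / δ := by
        rw [le_div_iff₀ hδ, mul_comm]; exact hcheb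
    _ ≤ (K / Real.sqrt (b n) + 2 * Real.sqrt (2 ^ 17 * Ch ^ 8 / a n)) / δ :=
        div_le_div_of_nonneg_right hL1 hδ.le

end Envelope

end Summit.Ventures.LatticeQCDFlow.Scoring

end
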